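import Mathlib
import HarnessLib
import Summits.NavierStokesRegularity.NavierStokesRegularity.Theorems.TaylorModelRungThreeCertificateFormatVGrowthRun

/-!
# Crux K1b-DR (stmt-NavierStokesRegularity-23954), line `taylor-model` — v3 growth checker, SOUNDNESS part 2:
# products enclose chains; every pair is tested; (R3) (tm-g4 g4)

`memMat_prodM` — `prodM j a n` encloses the coordinate matrix of the product kernel `kerOf (kiter Ac a n)` of every admissible
real chain (`memMat_kiter_one/succ` of `…ReadoutVGrowthBridge`); `pairTest_sound` — the pair test as real inequalities;
`facts_at`/`L1_bounds` — every sub-step `t < S` sits in chunk `t/L` (chunk length `L > 0`); **`pair_tested`** — every pair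
`(a', b)`, `a' ≤ b ≤ S`, `1 ≤ b`, was tested with the factor `gD a' b` (in-chunk, identity or split branch); **`hR3a_of_growth`**,
**`hR3b_of_growth`** — clause (R3) of `ReadoutsV` with `G := Gr`, `ΛT := ΛTr` (`= Λdes`); `ΛTr_nonneg`.
MODEL-lattice bookkeeping only (rung TL-M3); nothing here is a statement about the Navier–Stokes equations.
-/

-- the sub-problem namespace repeats the summit name by design (D-0017)
set_option linter.dupNamespace false

namespace Summit.NavierStokesRegularity.NavierStokesRegularity.Theorems.TaylorModelCert

open scoped BigOperators
open Literature.Analysis.FluidPDE.TaoCascade Literature.Analysis.FluidPDE.TaoCascade.TaylorChain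
open Summit.NavierStokesRegularity.NavierStokesRegularity.Theorems.TaylorModelReadout
open Summit.NavierStokesRegularity.NavierStokesRegularity.Theorems.TaylorModelV

namespace CertTablesV

variable {TV : CertTablesV} {kitOf : ℕ → CoreKit} {wT : ℕ → Array Dyad} {sc : ScalarsV}

/-! ### The products enclose the real chains -/

/-- The product kernel of the empty chain has the identity coordinate matrix. [folklore] -/
theorem matOfKer_kerOf_kiter_zero (A : ℕ → Ker) (a : ℕ) {r c : ℕ} (hr : r < TV.base.n) (hc : c < TV.base.n) :
    TV.base.matOfKer (kerOf (kiter (TV.toCertDataVW kitOf wT sc) A a 0)) r c = if r = c then (1:ℝ) else 0 := by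
  simp only [CertTables.matOfKer, kerOf_kiter_zero]
  by_cases h : r = c
  · subst h; simp
  · rw [if_neg h, if_neg]
    rintro ⟨h1, h2⟩
    exact h (by rw [← TV.base.idx_wi_wk hr, h1, h2, TV.base.idx_wi_wk hc])

/-- **`prodM` encloses every admissible chain**: if `A s' ∈ [Mlo j s', Mhi j s']` for `a ≤ s' < a + n`, the coordinate matrix of
the product kernel `kerOf (kiter A a n)` lies in `prodM j a n`. [folklore] -/
theorem memMat_prodM {j a : ℕ} {A : ℕ → Ker} :
    ∀ n : ℕ, (∀ s', a ≤ s' → s' < a + n →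
        KerMem (TV.toCertDataVW kitOf wT sc) (A s') ((TV.toBoxesW kitOf wT).Mlo j s') ((TV.toBoxesW kitOf wT).Mhi j s')) →
      MemMat TV.base.n (TV.base.matOfKer (kerOf (kiter (TV.toCertDataVW kitOf wT sc) A a n))) (TV.prodM kitOf wT j a n)
  | 0, _ => by
    intro r hr c hc
    rw [matOfKer_kerOf_kiter_zero (sc := sc) A a hr hc]
    exact memMat_idIM TV.base.n r hr c hc
  | 1, hA => by
    show MemMat TV.base.n _ (TV.Mk kitOf wT j a)
    exact TV.base.memMat_kiter_one cd_Kb cd_Ka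
      (TV.base.memMat_of_kerMem cd_Kb cd_Ka (hA a le_rfl (by omega)))
  | n + 2, hA => by
    show MemMat TV.base.n _ (mulII TV.base.n TV.prec (TV.Mk kitOf wT j (a + n + 1)) (TV.prodM kitOf wT j a (n + 1)))
    have ih := memMat_prodM (n + 1) (fun s' h1 h2 => hA s' h1 (by omega))
    have hM := TV.base.memMat_of_kerMem cd_Kb cd_Ka (hA (a + n + 1) (by omega) (by omega))
    have := TV.base.memMat_kiter_succ cd_Kb cd_Ka TV.prec (A := A) (s₀ := a) (n := n + 1) ih
      (by rw [show a + (n + 1) = a + n + 1 by omega]; exact hM)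
    exact this

/-! ### The pair test, unpacked -/

/-- **The pair test as real inequalities** (`a' ≥ 1`): `gL1[a'−1]·fac ≤ Λdes↓` and, for `b < S`, `gL1[a'−1]·fac·gL1[b] ≤ Λ↓`.
[folklore] -/
theorem pairTest_sound {j L q a' b : ℕ} {fac : Dyad} (h : (TV.gctx j L q).pairTest a' b fac = true) (ha' : a' ≠ 0)
    (hgb : b < TV.S j → 0 ≤ (dget (TV.gL1 j) b).toReal) :
    (dget (TV.gL1 j) (a' - 1)).toReal * fac.toReal ≤ (IntervalD.ofQS2 TV.prec (TV.stageV j).Λdes).lo.toReal ∧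
    (b < TV.S j → (dget (TV.gL1 j) (a' - 1)).toReal * fac.toReal * (dget (TV.gL1 j) b).toReal ≤
      (IntervalD.ofQS2 TV.prec (TV.base.stage j).Λ).lo.toReal) := by
  unfold GCtx.pairTest at h
  simp only [gctx_S, gctx_prec, gctx_gL1, Bool.or_eq_true, beq_iff_eq, ha', false_or, Bool.and_eq_true,
    decide_eq_true_eq] at h
  obtain ⟨h1, h2⟩ := h
  refine ⟨(Dyad.mul_le_mulUp TV.prec _ _).trans ((Dyad.ble_iff _ _).1 h1), fun hb => ?_⟩
  rcases h2 with hle | h2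
  · exfalso; omega
  · have h2' := (Dyad.ble_iff _ _).1 h2
    refine le_trans ?_ h2'
    exact le_trans (mul_le_mul_of_nonneg_right (Dyad.mul_le_mulUp TV.prec _ _) (hgb hb)) (Dyad.mul_le_mulUp TV.prec _ _)


/-! ### From the chunk Booleans to (R3) -/

/-- `t / L = q` on the chunk `[qL, qL + L)`. [folklore] -/
theorem div_eq_of_chunk {t L q : ℕ} (hL : 0 < L) (h1 : q * L ≤ t) (h2 : t < q * L + L) : t / L = q := by
  apply Nat.le_antisymm
  · have : t / L < q + 1 := (Nat.div_lt_iff_lt_mul hL).2 (by linarith)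
    omega
  · exact (Nat.le_div_iff_mul_le hL).2 h1

section Stage

variable {P : ℕ → CoreOut → Bool} {j L : ℕ} (hL : 0 < L)
  (hGR : ∀ q, q * L < TV.S j → TV.growthRange kitOf wT P j L q = true)
include hL hGR

/-- The run facts AT sub-step `t < S` (chunk `t/L`, offset `t − t/L·L`). [folklore] -/
theorem facts_at {t : ℕ} (ht : t < TV.S j) :
    ((TV.ctxOfW kitOf wT j).subStep t ((TV.ctxOfW kitOf wT j).nodeAt t)).ok = true ∧
    P t ((TV.ctxOfW kitOf wT j).subStep t ((TV.ctxOfW kitOf wT j).nodeAt t)).core = true ∧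
    (Dyad.ble Dyad.zero (TV.coreVW kitOf wT j t).L1 = true ∧ Dyad.ble (TV.coreVW kitOf wT j t).L1 (dget (TV.gL1 j) t) = true) ∧
    (∀ i', i' < t + 1 - t / L * L → (TV.gctx j L (t / L)).pairTest (t / L * L + i') (t + 1)
      ((TV.gctx j L (t / L)).facOf (TV.prodM kitOf wT j (t / L * L + i') (t + 1 - (t / L * L + i'))) (TV.ωhiV j)) = true) ∧
    (TV.gctx j L (t / L)).pairTest (t + 1) (t + 1) ((TV.gctx j L (t / L)).facOf (idIM TV.base.n) (TV.ωhiV j)) = true ∧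
    (∀ a' < t / L * L, (TV.gctx j L (t / L)).pairTest a' (t + 1)
      ((TV.gctx j L (t / L)).facOf (TV.prodM kitOf wT j (t / L * L) (t + 1 - t / L * L))
        ((TV.gctx j L (t / L)).W.getD a' #[])) = true) := by
  have h1 : t / L * L ≤ t := Nat.div_mul_le_self t L
  have h2 : t < t / L * L + L := Nat.lt_div_mul_add hL
  have hq : t / L * L < TV.S j := lt_of_le_of_lt h1 ht
  have hi : t - t / L * L < min L (TV.S j - t / L * L) := by
    apply lt_min <;> omega
  have h := (growthRange_sound (TV := TV) (kitOf := kitOf) (wT := wT) (hGR (t / L) hq)).1 (t - t / L * L) hi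
  have e : t / L * L + (t - t / L * L) = t := by omega
  rw [e] at h
  exact h

/-- `0 ≤ L1_t ≤ gL1[t]` as reals, for `t < S`. [folklore] -/
theorem L1_bounds {t : ℕ} (ht : t < TV.S j) :
    0 ≤ ((TV.coreVW kitOf wT j t).L1).toReal ∧ ((TV.coreVW kitOf wT j t).L1).toReal ≤ (dget (TV.gL1 j) t).toReal := by
  obtain ⟨-, -, ⟨h0, h1⟩, -⟩ := facts_at (TV := TV) (kitOf := kitOf) (wT := wT) hL hGR ht
  have h0' := (Dyad.ble_iff _ _).1 h0
  rw [Dyad.toReal_zero] at h0'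
  exact ⟨h0', (Dyad.ble_iff _ _).1 h1⟩

/-- **Every pair `(a', b)`, `a' ≤ b`, `1 ≤ b ≤ S`, was tested with the factor `gD a' b`.** [folklore] -/
theorem pair_tested {a' b : ℕ} (hb1 : 1 ≤ b) (hbS : b ≤ TV.S j) (hab : a' ≤ b) :
    (TV.gctx j L ((b - 1) / L)).pairTest a' b (TV.gD kitOf wT j L a' b) = true := by
  have ht : b - 1 < TV.S j := by omega
  obtain ⟨-, -, -, hIn, hDiag, hOut⟩ := facts_at (TV := TV) (kitOf := kitOf) (wT := wT) hL hGR ht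
  set qb := (b - 1) / L with hqb
  have h1 : qb * L ≤ b - 1 := Nat.div_mul_le_self _ L
  have h2 : b - 1 < qb * L + L := Nat.lt_div_mul_add hL
  have eb : b - 1 + 1 = b := by omega
  rw [eb] at hIn hDiag hOut
  rcases Nat.lt_or_ge a' (qb * L) with hlt | hge
  · -- earlier start: split factor
    have hdiv : a' / L < qb := (Nat.div_lt_iff_lt_mul hL).2 hlt
    have hW : (TV.gctx j L qb).W.getD a' #[] = TV.wVec j L a' (qb - (a' / L + 1)) := by
      show (Array.ofFn (n := qb * L) fun a' : Fin (qb * L) => TV.wVec j L a' (qb - (a' / L + 1))).getD a' #[] = _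
      rw [getD_ofFn_lt _ hlt]
    have h := hOut a' hlt
    rw [hW] at h
    have hnot : ¬ b ≤ (a' / L + 1) * L := by
      have : (a' / L + 1) * L ≤ qb * L := Nat.mul_le_mul_right L hdiv
      omega
    unfold gD
    rw [if_neg hnot]
    exact h
  · rcases Nat.lt_or_ge a' b with hltb | hgeb
    · -- start inside the chunk: direct factor
      have hi' : a' - qb * L < b - qb * L := by omega
      have h := hIn (a' - qb * L) hi'
      have e1 : qb * L + (a' - qb * L) = a' := by omega
      rw [e1] at h
      have hdiv : a' / L = qb := div_eq_of_chunk hL hge (by omega)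
      have hpos : b ≤ (a' / L + 1) * L := by rw [hdiv]; linarith
      unfold gD
      rw [if_pos hpos, hdiv, facOf_gctx j L qb qb]
      exact h
    · -- `a' = b`: identity factor
      have hab' : a' = b := le_antisymm hab hgeb
      subst hab'
      have hpos : a' ≤ (a' / L + 1) * L := by
        have := Nat.lt_div_mul_add (a := a') hL; linarith
      unfold gD
      rw [if_pos hpos, Nat.sub_self, facOf_gctx j L (a' / L) qb]
      exact hDiag

omit hL hGR in
/-- `0 ≤ gD`. [folklore] -/
theorem gD_nonneg (a b : ℕ) : 0 ≤ (TV.gD kitOf wT j L a b).toReal := by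
  unfold gD; split_ifs <;> exact GCtx.facOf_nonneg _ _ _

/-- **(R3a) from the growth Booleans.** [folklore] -/
theorem hR3a_of_growth (a b : ℕ) (ha : a < TV.S j) (hab : a + 1 ≤ b) (hb : b ≤ TV.S j) :
    (TV.toCertDataVW kitOf wT sc).L1 j a * TV.Gr kitOf wT j L (a + 1) b ≤ TV.ΛTr j ∧
    (b < TV.S j → (TV.toCertDataVW kitOf wT sc).L1 j a * TV.Gr kitOf wT j L (a + 1) b *
      (TV.toCertDataVW kitOf wT sc).L1 j b ≤ (TV.toCertDataVW kitOf wT sc).Λ j) := by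
  have hpt := pair_tested (TV := TV) (kitOf := kitOf) (wT := wT) hL hGR (a' := a + 1) (b := b) (by omega) hb hab
  have hgb : b < TV.S j → 0 ≤ (dget (TV.gL1 j) b).toReal := fun hb' =>
    (L1_bounds (TV := TV) (kitOf := kitOf) (wT := wT) hL hGR hb').1.trans (L1_bounds hL hGR hb').2
  obtain ⟨h1, h2⟩ := pairTest_sound (TV := TV) hpt (by omega) hgb
  simp only [Nat.add_sub_cancel] at h1 h2
  obtain ⟨hL1a0, hL1a⟩ := L1_bounds (TV := TV) (kitOf := kitOf) (wT := wT) hL hGR ha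
  have hG0 := gD_nonneg (TV := TV) (kitOf := kitOf) (wT := wT) (j := j) (L := L) (a + 1) b
  have hΛdes : ((IntervalD.ofQS2 TV.prec (TV.stageV j).Λdes).lo).toReal ≤ TV.ΛTr j := (IntervalD.mem_ofQS2 TV.prec _).1
  have hΛ : ((IntervalD.ofQS2 TV.prec (TV.base.stage j).Λ).lo).toReal ≤ (TV.toCertDataVW kitOf wT sc).Λ j :=
    (IntervalD.mem_ofQS2 TV.prec _).1
  rw [cd_L1]
  unfold Gr
  constructor
  · calc ((TV.coreVW kitOf wT j a).L1).toReal * (TV.gD kitOf wT j L (a + 1) b).toReal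
        ≤ (dget (TV.gL1 j) a).toReal * (TV.gD kitOf wT j L (a + 1) b).toReal := mul_le_mul_of_nonneg_right hL1a hG0
      _ ≤ _ := h1.trans hΛdes
  · intro hb'
    obtain ⟨hL1b0, hL1b⟩ := L1_bounds (TV := TV) (kitOf := kitOf) (wT := wT) hL hGR hb'
    rw [cd_L1]
    calc ((TV.coreVW kitOf wT j a).L1).toReal * (TV.gD kitOf wT j L (a + 1) b).toReal * ((TV.coreVW kitOf wT j b).L1).toReal
        ≤ (dget (TV.gL1 j) a).toReal * (TV.gD kitOf wT j L (a + 1) b).toReal * (dget (TV.gL1 j) b).toReal :=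
          mul_le_mul (mul_le_mul_of_nonneg_right hL1a hG0) hL1b hL1b0 (mul_nonneg (hL1a0.trans hL1a) hG0)
      _ ≤ _ := (h2 hb').trans hΛ

/-- **(R3b) from `checkL1` and the growth Booleans.** [folklore] -/
theorem hR3b_of_growth (hcL : TV.checkL1 j = true) (a : ℕ) (ha : a < TV.S j) :
    (TV.toCertDataVW kitOf wT sc).L1 j a ≤ (TV.toCertDataVW kitOf wT sc).Λ j := by
  unfold checkL1 at hcL
  simp only [Bool.and_eq_true, allN_eq_true, decide_eq_true_eq] at hcL
  have h := (Dyad.ble_iff _ _).1 (hcL.2 a ha)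
  have hΛ : ((IntervalD.ofQS2 TV.prec (TV.base.stage j).Λ).lo).toReal ≤ (TV.toCertDataVW kitOf wT sc).Λ j :=
    (IntervalD.mem_ofQS2 TV.prec _).1
  rw [cd_L1]
  exact ((L1_bounds (TV := TV) (kitOf := kitOf) (wT := wT) hL hGR ha).2.trans h).trans hΛ

omit hL hGR in
/-- `0 ≤ ΛT` from `checkL1`. [folklore] -/
theorem ΛTr_nonneg (hcL : TV.checkL1 j = true) : 0 ≤ TV.ΛTr j := by
  unfold checkL1 at hcL
  simp only [Bool.and_eq_true, decide_eq_true_eq] at hcL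
  have := (QS2.le_iff_toR _ _).1 hcL.1
  rw [QS2.toR_zero] at this
  exact this


end Stage

end CertTablesV

end Summit.NavierStokesRegularity.NavierStokesRegularity.Theorems.TaylorModelCert
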